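import Summits.BirchSwinnertonDyer.BirchSwinnertonDyer.Theorems.Rank1ResidualIntModelReduction
import HarnessLib

/-!
# Route `ErratumRoadFive` (rung K2), crux `NonSurjCorner` (item stmt-BirchSwinnertonDyer-19065), `p = 7` HALF:
# a TOOL for the per-pair instance files of the corner (cell `bsd-stepL`, seat `bsd-stepL-corner5-p2` g6, WIDTH-LEVER lane B;
# `--supports stmt-BirchSwinnertonDyer-19065 --as helper`)

WHAT. The instance pipeline `…NonSurjCornerSevenInstance<tag>.lean` (g0: Tm1o7 ∕ T17o7 ∕ T16o7; g6: T54o7 and the p7scan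
members) reads reduction data off a literal globally minimal integer model `E₀` through x11c's
`Rank1ResidualIntModelReduction`. One gap of that toolbox, closed here once for all instance files:

* `not_hasMultiplicativeReductionAtPrime_of_intModel_of_dvd_of_dvd` — **an additive prime is not multiplicative, WITHOUT
  the `q¹² ∤ Δ` shortcut**: for the globally minimal `W` with integral model `E₀` and a prime `q` with `q ∣ Δ(E₀)`,
  `q ∣ c₄(E₀)`: `¬ Mult W q` (global minimality supplies the minimality at `q` that the tree's
  `not_hasMultiplicativeReductionAtPrime_baseChange_int_of_dvd_of_dvd` takes from `q¹² ∤ Δ`; needed at the prime `2` of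
  the p7scan members, where `2¹⁴ ∣ Δ_min` with Kraus's pattern `2⁸ ∤ c₄ ∧ 2⁷ ∣ c₆`). Proof = the additive half of
  `not_semistable_of_intModel`, verbatim.
(The companion transport lemma `CornerSeven.T54o7.hasSplitMultiplicativeReductionAtPrime_of_eq` already lives in the T54o7 file.)

HONEST FRAMING: one elementary theorem (no definition, no named fact, no `sorry`); nothing about BSD or any class (T7).
References: [SilvermanAEC2009] VII.5 Prop. 5.1(c), VIII.8; tree `Theorems/Rank1ResidualIntModelReduction.lean`.
-/

set_option linter.dupNamespace false
set_option autoImplicit false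

noncomputable section

open scoped Classical

open IsDedekindDomain NumberField Rat.HeightOneSpectrum WeierstrassCurve
  Literature.NumberTheory.EllipticCurves Literature.NumberTheory.EllipticCurves.Rank1Residual

namespace Summit.BirchSwinnertonDyer.BirchSwinnertonDyer.Rank1Residual.IntModel

section

variable {W : WeierstrassCurve ℚ} [W.IsElliptic] [W.IsGloballyMinimal] {E₀ : WeierstrassCurve ℤ}
  (hI : integralModelInt W = E₀)
include hI

/-- **An additive prime of the globally minimal `W` is not multiplicative**: `q ∣ Δ(E₀)` and `q ∣ c₄(E₀)` for the
integral model `E₀` of `W` give additive reduction at the place of `q` (Silverman VII.5.1(c) at a minimal equation), which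
excludes multiplicative reduction there; no `q¹² ∤ Δ` hypothesis. [cite: SilvermanAEC2009, VII.5 Prop. 5.1(c)] -/
theorem not_hasMultiplicativeReductionAtPrime_of_intModel_of_dvd_of_dvd (q : ℕ) [hq : Fact q.Prime]
    (hΔ : (q : ℤ) ∣ E₀.Δ) (hc₄ : (q : ℤ) ∣ E₀.c₄) : ¬ W.HasMultiplicativeReductionAtPrime q := by
  intro hm
  set v : HeightOneSpectrum (𝓞 ℚ) := (primesEquiv (R := 𝓞 ℚ)).symm ⟨q, hq.out⟩ with hvdef
  have hv : primesEquiv v = ⟨q, hq.out⟩ := Equiv.apply_symm_apply _ _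
  haveI : Fact (primesEquiv v : ℕ).Prime := ⟨(primesEquiv v).2⟩
  have hadd : W.HasAdditiveReductionAt v := by
    rw [hasAdditiveReductionAt_iff_of_isMinimalAt (IsGloballyMinimal.isMinimal (W := W) v),
      Δ_eq_cast hI, c₄_eq_cast hI, (valuation_equiv_padicValuation v).lt_one_iff_lt_one,
      (valuation_equiv_padicValuation v).lt_one_iff_lt_one, Rat.padicValuation_cast,
      Rat.padicValuation_cast, Int.padicValuation_lt_one_iff, Int.padicValuation_lt_one_iff, hv]
    exact ⟨hΔ, hc₄⟩
  have key : ∀ q' : Nat.Primes, primesEquiv v = q' →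
      (haveI := Fact.mk q'.2; W.HasMultiplicativeReductionAtPrime (q' : ℕ)) →
        W.HasMultiplicativeReductionAt v := by
    rintro q' rfl h
    exact (hasMultiplicativeReductionAtPrime_iff_hasMultiplicativeReductionAt_ringOfIntegers W v).mp h
  exact hadd.not_hasMultiplicativeReductionAt (key ⟨q, hq.out⟩ hv hm)

end

end Summit.BirchSwinnertonDyer.BirchSwinnertonDyer.Rank1Residual.IntModel

end
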